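import Summits.QuantumFields.YangMills.Theorems.ConvexGribovBodyPoincareToGapDuality
import Summits.QuantumFields.YangMills.Theorems.ConvexGribovBodyPoincareToGapGlue

/-!
# One-slice and conditional projection bounds give two-time arc retention (crux
`ConvexGribovBody.PoincareToGap`, line `Sketch`: the second hypothesis-free composition)

Torus Wilson state `μ = wilsonMeasure r.ρ β` on `GaugeConfig 4 (2S+1) G`; time offsets `(e.1 0 - s).val`
from a slice `s`; `X_s` = the SPATIAL links at offset `0`, `E` = the spatial links at the offsets `0` and
`ℓ − 1` (the two end slices of the arc of `ℓ` slices from `s`), `O` = the links at offsets `≥ ℓ` (outside the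
arc), `P_D = μ[· | cylinderEvents D]`.

`stub_twoTimeRetention_of_projectionBounds`: if on all tori `S ≥ S₁`
* (PB1, `θ₁ ∈ [0,1)`) `Var(P_{X_s} h) ≤ θ₁ Var h` for every bounded measurable gauge-invariant `h` reading
  links other than `X_s`, for every slice `s`, and
* (PB2, `θ₂ ∈ [0,1)`) `‖P_E h − P_{X_s} h‖² ≤ θ₂ ‖h − P_{X_s} h‖²` for every bounded measurable gauge-invariant
  `h` reading only `O`, for every arc (`3 ≤ ℓ`, `ℓ + 3 ≤ 2S+1`),
then TWO-TIME ARC RETENTION holds on all tori `S ≥ S₁` with `ε = (1 − θ₁)(1 − θ₂) ∈ (0, 1]`: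
`ε Var F ≤ ‖F − P_O F‖²` for every bounded measurable gauge-invariant `F` reading only `E`.
Proof: the glue `stub_projectionBound_glue` (p106765) merges PB1 and PB2 into the two-slice projection bound
`Var(P_E h) ≤ (θ₁ + θ₂ − θ₁θ₂) Var h` for `h` reading `O`, and the duality `stub_retention_of_projectionBound`
(p104460) turns it into retention with `1 − (θ₁ + θ₂ − θ₁θ₂) = (1−θ₁)(1−θ₂)`.  Together with
`stub_gapAt_of_twoTimeRetention` this is the whole cyclic-peeling line minus its two open cores PB1, PB2
(registered stubs `stub_oneSliceProjectionBound_of_slicePoincare`, `stub_conditionalProjectionBound_of_slicePoincare`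
of `Cruxes/PoincareToGap/Lines/Sketch.lean`), stated without any Poincaré hypothesis.

References: F. Martinelli, LNM 1717 (1999), §3; K. Osterwalder, E. Seiler, Ann. Phys. 110 (1978), §2.
-/

noncomputable section

open scoped BigOperators Topology
open MeasureTheory ProbabilityTheory Filter
open Literature.MathematicalPhysics.QuantumFieldTheory Literature.MathematicalPhysics.QuantumLattice

namespace Summit.QuantumFields.YangMills.Theorems.PoincareToGap

/-- **PB1 ∧ PB2 ⇒ two-time arc retention** with `ε = (1 − θ₁)(1 − θ₂)`: the one-slice projection bound
(`θ₁`) and the conditional projection bound (`θ₂`) on all tori `S ≥ S₁` give, on the same tori, retention of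
the fraction `(1−θ₁)(1−θ₂)` of the variance of every bounded measurable gauge-invariant two-end-slice
observable under resampling of the arc (glue p106765 + duality p104460). -/
theorem stub_twoTimeRetention_of_projectionBounds :
    ∀ (G : Type) [Group G] [TopologicalSpace G] [IsTopologicalGroup G] [CompactSpace G]
      [MeasurableSpace G] [BorelSpace G] (r : LatticeRep G) (β θ₁ θ₂ : ℝ),
      0 ≤ θ₁ → θ₁ < 1 → 0 ≤ θ₂ → θ₂ < 1 → ∀ S₁ : ℕ,
    (∀ S : ℕ, S₁ ≤ S →
      ∀ μ : Measure (GaugeConfig 4 (2 * S + 1) G),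
        μ = (wilsonMeasure r.ρ β : Measure (GaugeConfig 4 (2 * S + 1) G)) →
      ∀ (s : ZMod (2 * S + 1)) (h : GaugeConfig 4 (2 * S + 1) G → ℝ), Measurable h →
        (∃ M : ℝ, ∀ U, |h U| ≤ M) → IsGaugeInvariant h →
        DependsOn h {e : Edge 4 (2 * S + 1) | ¬ ((e.1 0 - s).val = 0 ∧ e.2 ≠ 0)} →
      ∫ U, (condExp (cylinderEvents {e : Edge 4 (2 * S + 1) | (e.1 0 - s).val = 0 ∧ e.2 ≠ 0}) μ h U -
          ∫ V, h V ∂μ) ^ 2 ∂μ ≤ θ₁ * ∫ U, (h U - ∫ V, h V ∂μ) ^ 2 ∂μ) →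
    (∀ S : ℕ, S₁ ≤ S →
      ∀ μ : Measure (GaugeConfig 4 (2 * S + 1) G),
        μ = (wilsonMeasure r.ρ β : Measure (GaugeConfig 4 (2 * S + 1) G)) →
      ∀ (s : ZMod (2 * S + 1)) (ℓ : ℕ), 3 ≤ ℓ → ℓ + 3 ≤ 2 * S + 1 →
      ∀ h : GaugeConfig 4 (2 * S + 1) G → ℝ, Measurable h → (∃ M : ℝ, ∀ U, |h U| ≤ M) →
        IsGaugeInvariant h → DependsOn h {e : Edge 4 (2 * S + 1) | ℓ ≤ (e.1 0 - s).val} →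
      ∫ U, (condExp (cylinderEvents {e : Edge 4 (2 * S + 1) |
              ((e.1 0 - s).val = 0 ∨ (e.1 0 - s).val = ℓ - 1) ∧ e.2 ≠ 0}) μ h U -
            condExp (cylinderEvents {e : Edge 4 (2 * S + 1) | (e.1 0 - s).val = 0 ∧ e.2 ≠ 0}) μ h U) ^ 2 ∂μ ≤
        θ₂ * ∫ U, (h U -
            condExp (cylinderEvents {e : Edge 4 (2 * S + 1) | (e.1 0 - s).val = 0 ∧ e.2 ≠ 0}) μ h U) ^ 2 ∂μ) →
    ∀ S : ℕ, S₁ ≤ S →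
      ∀ μ : Measure (GaugeConfig 4 (2 * S + 1) G),
        μ = (wilsonMeasure r.ρ β : Measure (GaugeConfig 4 (2 * S + 1) G)) →
      ∀ (s : ZMod (2 * S + 1)) (ℓ : ℕ), 3 ≤ ℓ → ℓ + 3 ≤ 2 * S + 1 →
      ∀ F : GaugeConfig 4 (2 * S + 1) G → ℝ, Measurable F → (∃ M : ℝ, ∀ U, |F U| ≤ M) →
        IsGaugeInvariant F →
        DependsOn F {e : Edge 4 (2 * S + 1) |
          ((e.1 0 - s).val = 0 ∨ (e.1 0 - s).val = ℓ - 1) ∧ e.2 ≠ 0} →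
      (1 - θ₁) * (1 - θ₂) * ∫ U, (F U - ∫ V, F V ∂μ) ^ 2 ∂μ ≤
        ∫ U, (F U - condExp (cylinderEvents {e : Edge 4 (2 * S + 1) | ℓ ≤ (e.1 0 - s).val}) μ F U) ^ 2 ∂μ := by
  intro G _ _ _ _ _ _ r β θ₁ θ₂ h10 _h11 h20 h21 S₁ hPB1 hPB2 S hS μ hμ s ℓ h3 hℓ F hFm hFb hFi hFd
  have hglue := stub_projectionBound_glue G r β S μ hμ s ℓ θ₁ θ₂ h10 h20 h21.le (by omega)
    (fun h' hm' hb' hi' hd' => hPB1 S hS μ hμ s h' hm' hb' hi' hd') (hPB2 S hS μ hμ s ℓ h3 hℓ)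
  have hret := stub_retention_of_projectionBound G r β S μ hμ _ _ (θ₁ + θ₂ - θ₁ * θ₂) (by nlinarith)
    hglue F hFm hFb hFi hFd
  have hε : (1 - θ₁) * (1 - θ₂) = 1 - (θ₁ + θ₂ - θ₁ * θ₂) := by ring
  rw [hε]
  exact hret

end Summit.QuantumFields.YangMills.Theorems.PoincareToGap

end
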